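import Literature.Probability.LatticeModels.CollarLegModelStrandsExpansion
import Summits.CriticalPhenomena.CardyFormulaZ2.Theorems.CardyBoundaryCoulombGasBoundaryDefectGaussianRStubRealisabilityPart13
import Summits.CriticalPhenomena.CardyFormulaZ2.Theorems.CardyBoundaryCoulombGasBoundaryDefectGaussianRStubRealisabilityPart18

/-!
# Stub `stub_realisability` of line `rainbow-monomials-in-excursion-kernels` — Part 19:
# the frozen consistency transfer (hypothesis (H2) of the rainbow forcing, from Lemma C)
# (crux `BoundaryDefectGaussianR`, stmt-CriticalPhenomena-14132; insertion dictionary D2, layer 3b)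

Part 18 (`joined_or_joined_of_consistent`, `rainbow_of_strandEnds`) forces the rainbow event from
the consistency of all live turns, given among its inputs the FROZEN CONSISTENCY TRANSFER

  (H2) `∀ c, ¬M.TargetsLive c → M.TurnConsistent 0 (M.cfgOf ∅) c → M.TurnConsistent h (M.cfgOf ω) c`

(a frozen turn that is a consistent tracked turn of the prescribed data is one for `h` in the
completed configuration of `ω`). This file discharges (H2) from Lemma C of Part 13
(`openEdges_hv_eq`: the endpoints of a frozen open edge are prescribed; `closed_hf_eq`: for an
admissible insertion on a pinch-free `V`, the side faces of a closed frozen edge are prescribed):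

* `exists_eq_cIn_or_cOut` — every corner is one of the two corners `cIn e`, `cOut e` arriving at
  its target edge `e` (coded edge of `SixVertex`);
* `hv_eq_hv_of_frozen_open` — at a frozen OPEN target the two vertex heights a turn compares do not
  depend on the configuration (general `M`); `hf_eq_hf_of_frozen_closed` — at a frozen CLOSED
  target of a tracked corner the two face heights do not depend on it (admissible, pinch-free);
* `turnConsistent_frozen_iff` — hence the consistency of a frozen turn depends neither on `h` nor
  on `ω ⊆ M.E`; `frozen_transfer` — (H2);
* `rainbow_of_strandEnds_of_admissible` — Part 18's rainbow forcing with (H2) discharged: the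
  remaining inputs are (H1) (all live turns consistent), the conclusions of the registered
  strand-end lemmas `s14_strandEnds_pairs/_tags`, and the end identification (E1)–(E3).
-/

namespace Summit.CriticalPhenomena.CardyFormulaZ2.Cruxes.BoundaryDefectGaussianR.RainbowMonomialsInExcursionKernels

open Finset Literature.Probability.LatticeModels Literature.Probability.LatticeModels.CollarLegModel

section FrozenTransfer

/-- **Every corner arrives at a coded edge**: `c = cIn e` (target edge leaving the vertex of `c`
east or north) or `c = cOut e` (west or south). [folklore] -/
theorem exists_eq_cIn_or_cOut (c : Site 2 × Fin 4) : ∃ e : (ℤ × ℤ) × Bool, c = cIn e ∨ c = cOut e := by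
  obtain ⟨v, k⟩ := c
  have hv : toSite (ofSite v) = v := by funext i; fin_cases i <;> simp [toSite, ofSite]
  fin_cases k
  · exact ⟨(ofSite v, true), Or.inl (by rw [cIn, hv]; rfl)⟩
  · refine ⟨(((ofSite v).1 - 1, (ofSite v).2), false), Or.inr ?_⟩
    rw [cOut]
    simp only [SixVertex.edgeTip, Bool.false_eq_true, ↓reduceIte, sub_add_cancel, Prod.mk.eta, hv]
    rfl
  · refine ⟨(((ofSite v).1, (ofSite v).2 - 1), true), Or.inr ?_⟩
    rw [cOut]
    simp only [SixVertex.edgeTip, ↓reduceIte, sub_add_cancel, Prod.mk.eta, hv]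
    rfl
  · exact ⟨(ofSite v, false), Or.inl (by rw [cIn, hv]; rfl)⟩

variable {M : CollarLegModel} {ω : Finset ((ℤ × ℤ) × Bool)}

/-- A frozen target edge that is open in the completed configuration of `ω ⊆ M.E` is a frozen open
edge of the model. [folklore] -/
theorem mem_openEdges_of_frozen_open (hω : ω ⊆ M.E) {e : (ℤ × ℤ) × Bool} (he : e ∉ M.E)
    (hm : edgeSym2 e ∈ M.cfgOf ω) : e ∈ M.openEdges := by
  rcases (M.edgeSym2_mem_cfgOf_iff ω e).1 hm with h | h
  · exact absurd (hω h) he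
  · exact h

/-- **Open frozen turns compare prescribed vertex heights** (from (C-open) of Part 13, general
`M`): at a corner whose frozen target edge is open in `cfgOf ω`, `ω ⊆ M.E`, the heights of its
vertex and of the vertex of the next corner are the same in any two configurations. [folklore] -/
theorem hv_eq_hv_of_frozen_open (hω : ω ⊆ M.E) {c : Site 2 × Fin 4} (hc : ¬M.TargetsLive c)
    (hm : cTgt c ∈ M.cfgOf ω) (h h' : ↥M.freeCells → ℤ) :
    M.hv h (ofSite c.1) = M.hv h' (ofSite c.1) ∧
      M.hv h (ofSite (nextCorner (M.cfgOf ω) c).1) = M.hv h' (ofSite (nextCorner (M.cfgOf ω) c).1) := by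
  rw [nextCorner_of_mem hm]
  obtain ⟨e, rfl | rfl⟩ := exists_eq_cIn_or_cOut c
  · rw [cTgt_cIn] at hm
    have he : e ∉ M.E := fun h1 => hc ((M.targetsLive_cIn_iff e).2 h1)
    have ho := mem_openEdges_of_frozen_open hω he hm
    simp only [ofSite_cIn_fst, ofSite_cIn_fst_add]
    exact ⟨by rw [(openEdges_hv_eq M ho h).1, (openEdges_hv_eq M ho h').1],
      by rw [(openEdges_hv_eq M ho h).2, (openEdges_hv_eq M ho h').2]⟩
  · rw [cTgt_cOut] at hm
    have he : e ∉ M.E := fun h1 => hc ((M.targetsLive_cOut_iff e).2 h1)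
    have ho := mem_openEdges_of_frozen_open hω he hm
    simp only [ofSite_cOut_fst, ofSite_cOut_fst_add]
    exact ⟨by rw [(openEdges_hv_eq M ho h).2, (openEdges_hv_eq M ho h').2],
      by rw [(openEdges_hv_eq M ho h).1, (openEdges_hv_eq M ho h').1]⟩

variable (ι : LegInsertionData) (V : Finset (ℤ × ℤ))

/-- **Closed frozen turns of tracked corners compare prescribed face heights** (from (C-closed) of
Part 13: admissible insertion, pinch-free `V`): at a tracked corner whose frozen target edge is
closed in `cfgOf ω`, `ω ⊆ E`, the heights of its face and of the face of the next corner are the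
same in any two configurations. [folklore] -/
theorem hf_eq_hf_of_frozen_closed (hadm : ι.IsAdmissible V)
    (hnp : ∀ x y : ℤ, ((x, y) ∈ V → (x + 1, y + 1) ∈ V → (x + 1, y) ∈ V ∨ (x, y + 1) ∈ V) ∧
      ((x + 1, y) ∈ V → (x, y + 1) ∈ V → (x, y) ∈ V ∨ (x + 1, y + 1) ∈ V))
    {ω : Finset ((ℤ × ℤ) × Bool)} {c : Site 2 × Fin 4}
    (hc : ¬(ι.model V).TargetsLive c) (hm : cTgt c ∉ (ι.model V).cfgOf ω) (ht : (ι.model V).IsTracked c)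
    (h h' : ↥(ι.model V).freeCells → ℤ) :
    (ι.model V).hf h (ofSite (cFace c)) = (ι.model V).hf h' (ofSite (cFace c)) ∧
      (ι.model V).hf h (ofSite (cFace (nextCorner ((ι.model V).cfgOf ω) c))) =
        (ι.model V).hf h' (ofSite (cFace (nextCorner ((ι.model V).cfgOf ω) c))) := by
  rw [nextCorner_of_not_mem hm]
  -- the coded target edge is a closed frozen edge of the model
  have key : ∀ e : (ℤ × ℤ) × Bool, edgeSym2 e = cTgt c → (e.1 ∈ (ι.model V).vertexCells ∨
      SixVertex.edgeTip e ∈ (ι.model V).vertexCells) →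
      ∀ s, ∀ g g' : ↥(ι.model V).freeCells → ℤ,
        (ι.model V).hf g (SixVertex.leftFace e s) = (ι.model V).hf g' (SixVertex.leftFace e s) := by
    intro e he hv s g g'
    have hE : e ∉ (ι.model V).E := fun h1 => hc (by rw [TargetsLive, ← he]; exact mem_image_of_mem _ h1)
    have hfr : e ∈ (ι.model V).frozenEdges :=
      mem_sdiff.2 ⟨(SixVertex.mem_edges_iff _ _).2 hv, hE⟩
    have hno : e ∉ (ι.model V).openEdges := fun ho =>
      hm (by rw [← he]; exact ((ι.model V).edgeSym2_mem_cfgOf_iff ω e).2 (Or.inr ho))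
    rw [closed_hf_eq ι V hadm hnp hfr hno s g, closed_hf_eq ι V hadm hnp hfr hno s g']
  obtain ⟨e, rfl | rfl⟩ := exists_eq_cIn_or_cOut c
  · have hv : e.1 ∈ (ι.model V).vertexCells := by have := ht.1; rwa [ofSite_cIn_fst] at this
    rw [ofSite_cFace_cIn, ofSite_cFace_cIn_succ]
    exact ⟨key e (cTgt_cIn e).symm (Or.inl hv) false h h', key e (cTgt_cIn e).symm (Or.inl hv) true h h'⟩
  · have hv : SixVertex.edgeTip e ∈ (ι.model V).vertexCells := by
      have := ht.1; rwa [ofSite_cOut_fst] at this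
    rw [ofSite_cFace_cOut, ofSite_cFace_cOut_succ]
    exact ⟨key e (cTgt_cOut e).symm (Or.inr hv) true h h', key e (cTgt_cOut e).symm (Or.inr hv) false h h'⟩

/-- **The consistency of a frozen turn depends neither on the height configuration nor on the open
live edges** (Lemma C of D2, turn form): for `ω, ω' ⊆ E` and any `h, h'`,
`TurnConsistent h (cfgOf ω) c → TurnConsistent h' (cfgOf ω') c` at every corner with frozen
target. [cite: BaxterKellandWu1976, §4] -/
theorem turnConsistent_frozen_transfer (hadm : ι.IsAdmissible V)
    (hnp : ∀ x y : ℤ, ((x, y) ∈ V → (x + 1, y + 1) ∈ V → (x + 1, y) ∈ V ∨ (x, y + 1) ∈ V) ∧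
      ((x + 1, y) ∈ V → (x, y + 1) ∈ V → (x, y) ∈ V ∨ (x + 1, y + 1) ∈ V))
    {ω ω' : Finset ((ℤ × ℤ) × Bool)} (hω : ω ⊆ (ι.model V).E) (hω' : ω' ⊆ (ι.model V).E)
    (h h' : ↥(ι.model V).freeCells → ℤ) {c : Site 2 × Fin 4} (hc : ¬(ι.model V).TargetsLive c)
    (htc : (ι.model V).TurnConsistent h ((ι.model V).cfgOf ω) c) :
    (ι.model V).TurnConsistent h' ((ι.model V).cfgOf ω') c := by
  have hσ : nextCorner ((ι.model V).cfgOf ω') c = nextCorner ((ι.model V).cfgOf ω) c := by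
    rw [nextCorner_cfgOf_eq_of_not_targetsLive hω' hc, nextCorner_cfgOf_eq_of_not_targetsLive hω hc]
  have hmem : cTgt c ∈ (ι.model V).cfgOf ω' ↔ cTgt c ∈ (ι.model V).cfgOf ω := by
    rw [cTgt_mem_cfgOf_iff_of_not_targetsLive hω' hc, cTgt_mem_cfgOf_iff_of_not_targetsLive hω hc]
  obtain ⟨ht, ht', hop, hcl⟩ := htc
  unfold TurnConsistent
  rw [hσ]
  refine ⟨ht, ht', fun hm => ?_, fun hm => ?_⟩
  · have hm0 := hmem.1 hm
    have ind := hv_eq_hv_of_frozen_open hω hc hm0 h h'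
    rw [← ind.1, ← ind.2]
    exact hop hm0
  · have hm0 : cTgt c ∉ (ι.model V).cfgOf ω := fun h1 => hm (hmem.2 h1)
    have ind := hf_eq_hf_of_frozen_closed ι V hadm hnp hc hm0 ht h h'
    rw [← ind.1, ← ind.2]
    exact hcl hm0

/-- Iff form of `turnConsistent_frozen_transfer`. [cite: BaxterKellandWu1976, §4] -/
theorem turnConsistent_frozen_iff (hadm : ι.IsAdmissible V)
    (hnp : ∀ x y : ℤ, ((x, y) ∈ V → (x + 1, y + 1) ∈ V → (x + 1, y) ∈ V ∨ (x, y + 1) ∈ V) ∧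
      ((x + 1, y) ∈ V → (x, y + 1) ∈ V → (x, y) ∈ V ∨ (x + 1, y + 1) ∈ V))
    {ω ω' : Finset ((ℤ × ℤ) × Bool)} (hω : ω ⊆ (ι.model V).E) (hω' : ω' ⊆ (ι.model V).E)
    (h h' : ↥(ι.model V).freeCells → ℤ) {c : Site 2 × Fin 4} (hc : ¬(ι.model V).TargetsLive c) :
    (ι.model V).TurnConsistent h ((ι.model V).cfgOf ω) c ↔ (ι.model V).TurnConsistent h' ((ι.model V).cfgOf ω') c :=
  ⟨turnConsistent_frozen_transfer ι V hadm hnp hω hω' h h' hc,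
    turnConsistent_frozen_transfer ι V hadm hnp hω' hω h' h hc⟩

/-- **(H2) of Part 18**: a frozen turn that is a consistent tracked turn of the prescribed data
(zero configuration, no open live edge — the reading of `IsCut`) is consistent for every `h` in
the completed configuration of every `ω ⊆ E`. [cite: BaxterKellandWu1976, §4] -/
theorem frozen_transfer (hadm : ι.IsAdmissible V)
    (hnp : ∀ x y : ℤ, ((x, y) ∈ V → (x + 1, y + 1) ∈ V → (x + 1, y) ∈ V ∨ (x, y + 1) ∈ V) ∧
      ((x + 1, y) ∈ V → (x, y + 1) ∈ V → (x, y) ∈ V ∨ (x + 1, y + 1) ∈ V))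
    {ω : Finset ((ℤ × ℤ) × Bool)} (hω : ω ⊆ (ι.model V).E) (h : ↥(ι.model V).freeCells → ℤ) :
    ∀ c, ¬(ι.model V).TargetsLive c → (ι.model V).TurnConsistent (fun _ => 0) ((ι.model V).cfgOf ∅) c →
      (ι.model V).TurnConsistent h ((ι.model V).cfgOf ω) c :=
  fun _ hc => turnConsistent_frozen_transfer ι V hadm hnp (empty_subset _) hω _ h hc

/-- Conversely a cut is inconsistent for every `h` and `ω ⊆ E`: the strands of every configuration
of nonzero weight stop at the cuts. [cite: BaxterKellandWu1976, §4] -/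
theorem not_turnConsistent_of_isCut (hadm : ι.IsAdmissible V)
    (hnp : ∀ x y : ℤ, ((x, y) ∈ V → (x + 1, y + 1) ∈ V → (x + 1, y) ∈ V ∨ (x, y + 1) ∈ V) ∧
      ((x + 1, y) ∈ V → (x, y + 1) ∈ V → (x, y) ∈ V ∨ (x + 1, y + 1) ∈ V))
    {ω : Finset ((ℤ × ℤ) × Bool)} (hω : ω ⊆ (ι.model V).E) (h : ↥(ι.model V).freeCells → ℤ)
    {c : Site 2 × Fin 4} (hc : (ι.model V).IsCut c) : ¬(ι.model V).TurnConsistent h ((ι.model V).cfgOf ω) c :=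
  fun htc => hc.2 (turnConsistent_frozen_transfer ι V hadm hnp hω (empty_subset _) h _ hc.1 htc)

end FrozenTransfer

section Rainbow

variable (ι : LegInsertionData) (V : Finset (ℤ × ℤ))

/-- **Rainbow forcing for an admissible insertion on a pinch-free `V`** (Part 18 with (H2)
discharged by Lemma C): if every live turn over the piece is consistent for the valid
configuration `h` in `cfgOf ω`, `ω ⊆ E`, then `ω` is a rainbow configuration — given the
conclusions `hpairs`, `htags` of the registered strand-end lemmas `s14_strandEnds_pairs/_tags` and
the identification (E1)–(E3) of the registered ends with the strand ends adjacent to cuts.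
[cite: BaxterKellandWu1976, §3–§4] -/
theorem rainbow_of_strandEnds_of_admissible (hadm : ι.IsAdmissible V)
    (hnp : ∀ x y : ℤ, ((x, y) ∈ V → (x + 1, y + 1) ∈ V → (x + 1, y) ∈ V ∨ (x, y + 1) ∈ V) ∧
      ((x + 1, y) ∈ V → (x, y + 1) ∈ V → (x, y) ∈ V ∨ (x + 1, y + 1) ∈ V))
    {ω : Finset ((ℤ × ℤ) × Bool)} {h : ↥(ι.model V).freeCells → ℤ} (hω : ω ⊆ (ι.model V).E)
    (H1 : ∀ c ∈ Literature.Probability.Percolation.cornerSet (ι.model V).piece,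
      (ι.model V).TargetsLive c → (ι.model V).TurnConsistent h ((ι.model V).cfgOf ω) c)
    (hpairs : ∀ e ∈ ι.strandEnds V, (ι.model V).IsTracked e.1 ∧ ∀ h : ↥(ι.model V).freeCells → ℤ,
      (ι.model V).IsValid h →
        min ((ι.model V).hv h (ofSite e.1.1)) ((ι.model V).hf h (ofSite (cFace e.1))) = e.2 ∧
          max ((ι.model V).hv h (ofSite e.1.1)) ((ι.model V).hf h (ofSite (cFace e.1))) = e.2 + 1)
    (htags : (∀ e ∈ ι.strandEnds V, -(ι.sinkLegs : ℤ) ≤ e.2 ∧ e.2 ≤ -1) ∧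
      (∀ m : ℤ, -(ι.sinkLegs : ℤ) ≤ m → m ≤ -1 → ((ι.strandEnds V).filter (fun e => e.2 = m)).card = 2) ∧
      (∀ e ∈ ι.strandEnds V, ∀ e' ∈ ι.strandEnds V, e.1 = e'.1 → e = e') ∧
      (ι.strandEnds V).card = 2 * ι.sinkLegs)
    (E1 : ∀ c, (ι.model V).IsTracked c → (ι.model V).IsCut c → ∃ m : ℤ, (c, m) ∈ ι.strandEnds V)
    (E2 : ∀ e ∈ ι.strandEnds V, ¬(ι.model V).IsCut e.1 →
      ∃ c, (ι.model V).IsCut c ∧ nextCorner ((ι.model V).cfgOf ∅) c = e.1)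
    (E3 : ∀ e ∈ ι.strandEnds V, ∀ e' ∈ ι.strandEnds V, e.2 = e'.2 → e.1 ≠ e'.1 →
      ¬((ι.model V).IsCut e.1 ∧ (ι.model V).IsCut e'.1))
    (hvalid : (ι.model V).IsValid h) : ι.Rainbow V ω :=
  rainbow_of_strandEnds ι V hω H1 (frozen_transfer ι V hadm hnp hω h) hpairs htags E1 E2 E3 hvalid

end Rainbow


/-- Registered sub-goal `s14_frozenTransfer` of `stub_realisability` (D2, layer 3b): hypothesis
(H2) of the rainbow forcing `s14_rainbow_of_valid` for the jump collar of an ADMISSIBLE insertion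
on a PINCH-FREE `V` — a frozen turn that is a consistent tracked turn of the prescribed data is
consistent for every height configuration in the completed configuration of every `ω ⊆ E`
(one-line form of `frozen_transfer`). [cite: BaxterKellandWu1976, §4] -/
theorem s14_frozenTransfer : ∀ (ι : Literature.Probability.LatticeModels.CollarLegModel.LegInsertionData) (V : Finset (ℤ × ℤ)), ι.IsAdmissible V → (∀ x y : ℤ, ((x, y) ∈ V → (x + 1, y + 1) ∈ V → (x + 1, y) ∈ V ∨ (x, y + 1) ∈ V) ∧ ((x + 1, y) ∈ V → (x, y + 1) ∈ V → (x, y) ∈ V ∨ (x + 1, y + 1) ∈ V)) → ∀ (ω : Finset ((ℤ × ℤ) × Bool)) (h : ↥(Literature.Probability.LatticeModels.CollarLegModel.LegInsertionData.model ι V).freeCells → ℤ), ω ⊆ (Literature.Probability.LatticeModels.CollarLegModel.LegInsertionData.model ι V).E → ∀ c : Literature.Probability.LatticeModels.Site 2 × Fin 4, ¬(Literature.Probability.LatticeModels.CollarLegModel.LegInsertionData.model ι V).TargetsLive c → (Literature.Probability.LatticeModels.CollarLegModel.LegInsertionData.model ι V).TurnConsistent (fun _ => 0) ((Literature.Probability.LatticeModels.CollarLegModel.LegInsertionData.model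 ι V).cfgOf ∅) c → (Literature.Probability.LatticeModels.CollarLegModel.LegInsertionData.model ι V).TurnConsistent h ((Literature.Probability.LatticeModels.CollarLegModel.LegInsertionData.model ι V).cfgOf ω) c :=
  fun ι V hadm hnp _ h hω => frozen_transfer ι V hadm hnp hω h

end Summit.CriticalPhenomena.CardyFormulaZ2.Cruxes.BoundaryDefectGaussianR.RainbowMonomialsInExcursionKernels
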